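import Literature.Probability.MarkovChains.ProductChains

/-!
HONEST FRAMING: exact (Metropolis-corrected) sampling algorithms for lattice gauge theory; figures
of merit are autocorrelation/cost numbers at stated couplings and volumes; no continuum-physics
claim.

# FlowSwapAcceptanceTwoSided — THE ACCEPTANCE OF A MAP-ASSISTED SWAP BETWEEN TWO LEVELS IS PINNED BY THE MAP'S
# TRANSPORT QUALITY: `r² ≤ Σ_{u,v} min{μ_a(u)μ_b(v), μ_a(φ⁻¹v)μ_b(φu)} ≤ 1 − ½Σ_u |μ_a(u) − μ_b(φu)|`
# (lean-2 GEN-19, ours)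

Venture-side (OURS).  Cell `lqcd-flow` (pub-lqcd), unit `pub-lqcd-lean-2-g19`, 2026-08-25.  Chapter F, measure
level (two levels `a`, `b` with positive probability vectors `μ_a`, `μ_b` on a finite configuration space and a
bijection `φ`, the trained map from level `a` to level `b`).  The map-assisted swap proposes
`(u, v) ↦ (φ⁻¹v, φu)` and is Metropolis-corrected against `μ_a ⊗ μ_b`; its stationary acceptance is the
two-level sum `Acc(φ) = Σ_{u,v} min{μ_a(u)μ_b(v), μ_a(φ⁻¹v)μ_b(φu)}` (for the replica-exchange sampler of
`Scaling/ReplicaExchangeFlowSwap` the other levels marginalise out; `φ = 1` is the bare swap of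
`Scaling/ReplicaExchangeBareAcceptance`).

## What is proved (def-free; the sums are written out)

* §1 **`flowPair_acceptance_ge_sq`** — TWO-SIDED RATIO CONTROL IS ENOUGH: if `r·μ_a(u) ≤ μ_b(φu)` and
  `r·μ_b(φu) ≤ μ_a(u)` for all `u` (`0 ≤ r ≤ 1`), then `Acc(φ) ≥ r²`; **`flowPair_acceptance_eq_one`** — a perfect
  transport (`μ_b(φu) = μ_a(u)`) is accepted surely.
* §2 **`flowPair_acceptance_le_marginal`** — `Acc(φ) ≤ Σ_u min{μ_a(u), μ_b(φu)}`; **`sum_min_eq_one_sub_tv`** — `Σ_u min{μ_a(u), μ_b(φu)} = 1 − ½Σ_u|μ_a(u) − μ_b(φu)|`;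
  **`flowPair_acceptance_le_one_sub_tv`** — THE TRANSPORT DEFECT IS A HARD CEILING:
  `Acc(φ) ≤ 1 − ½Σ_u |μ_a(u) − μ_b(φu)|` (total variation between `μ_a` and the pull-back `μ_b∘φ`).

Reading (no numerics implied): a map whose log-density-ratio error is uniformly small keeps every swap accepted at a
rate bounded below independently of everything else; a map whose push-forward misses `μ_b` by total variation `δ`
cannot be accepted more often than `1 − δ`, however the proposal is scheduled.  NOT CLAIMED: that trained flows
achieve a volume-independent `r`; anything measured.  Literature grade (cell rule): ELEMENTARY, NEW TYPING; nothing
cited as a fact; no new bib keys.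
-/

noncomputable section

open Finset

namespace Summit.Ventures.LatticeQCDFlow.Scaling

variable {S : Type*} [Fintype S]

/-! ## §1 The floor: two-sided ratio control -/

/-- **`Acc(φ) ≥ r²` under two-sided ratio control** `r·μ_a(u) ≤ μ_b(φu)`, `r·μ_b(φu) ≤ μ_a(u)` (`0 ≤ r ≤ 1`, `μ_a, μ_b ≥ 0`
probability vectors). [ours] -/
theorem flowPair_acceptance_ge_sq {μa μb : S → ℝ} (hμa : ∀ u, 0 ≤ μa u) (hμb : ∀ u, 0 ≤ μb u)
    (hμa1 : ∑ u, μa u = 1) (hμb1 : ∑ u, μb u = 1) (φ : Equiv.Perm S) {r : ℝ} (hr0 : 0 ≤ r) (hr1 : r ≤ 1)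
    (hab : ∀ u, r * μa u ≤ μb (φ u)) (hba : ∀ u, r * μb (φ u) ≤ μa u) :
    r ^ 2 ≤ ∑ u, ∑ v, min (μa u * μb v) (μa (φ.symm v) * μb (φ u)) := by
  have hterm : ∀ u v, r ^ 2 * (μa u * μb v) ≤ min (μa u * μb v) (μa (φ.symm v) * μb (φ u)) := by
    intro u v
    refine le_min ?_ ?_
    · have h0 : 0 ≤ μa u * μb v := mul_nonneg (hμa u) (hμb v)
      nlinarith [pow_le_one₀ (n := 2) hr0 hr1]
    · have h1 := hab u
      have h2 := hba (φ.symm v)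
      rw [Equiv.apply_symm_apply] at h2
      calc r ^ 2 * (μa u * μb v) = (r * μa u) * (r * μb v) := by ring
        _ ≤ μb (φ u) * μa (φ.symm v) :=
            mul_le_mul h1 h2 (mul_nonneg hr0 (hμb v)) (hμb _)
        _ = μa (φ.symm v) * μb (φ u) := mul_comm _ _
  calc r ^ 2 = r ^ 2 * ((∑ u, μa u) * ∑ v, μb v) := by rw [hμa1, hμb1]; ring
    _ = ∑ u, ∑ v, r ^ 2 * (μa u * μb v) := by
        rw [Finset.sum_mul_sum, Finset.mul_sum]
        exact sum_congr rfl fun u _ => by rw [Finset.mul_sum]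
    _ ≤ _ := sum_le_sum fun u _ => sum_le_sum fun v _ => hterm u v

/-- **A perfect transport is accepted surely:** `μ_b(φu) = μ_a(u)` for all `u` ⇒ `Acc(φ) = 1`. [ours] -/
theorem flowPair_acceptance_eq_one {μa μb : S → ℝ} (hμa1 : ∑ u, μa u = 1) (hμb1 : ∑ u, μb u = 1)
    (φ : Equiv.Perm S) (hφ : ∀ u, μb (φ u) = μa u) :
    ∑ u, ∑ v, min (μa u * μb v) (μa (φ.symm v) * μb (φ u)) = 1 := by
  have hterm : ∀ u v, min (μa u * μb v) (μa (φ.symm v) * μb (φ u)) = μa u * μb v := by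
    intro u v
    have h2 : μa (φ.symm v) = μb v := by rw [← hφ (φ.symm v), Equiv.apply_symm_apply]
    rw [hφ u, h2, mul_comm (μb v) (μa u), min_self]
  simp_rw [hterm]
  rw [← Finset.sum_mul_sum, hμa1, hμb1, mul_one]

/-! ## §2 The ceiling: the transport defect -/

/-- **`Acc(φ) ≤ Σ_u min{μ_a(u), μ_b(φu)}`** (the sum of minima is at most the minimum of the marginal sums;
`μ_a, μ_b ≥ 0`, `Σμ_a = Σμ_b = 1`). [ours] -/
theorem flowPair_acceptance_le_marginal {μa μb : S → ℝ} (hμa1 : ∑ u, μa u = 1) (hμb1 : ∑ u, μb u = 1)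
    (φ : Equiv.Perm S) :
    ∑ u, ∑ v, min (μa u * μb v) (μa (φ.symm v) * μb (φ u)) ≤ ∑ u, min (μa u) (μb (φ u)) := by
  refine sum_le_sum fun u _ => le_min ?_ ?_
  · calc ∑ v, min (μa u * μb v) (μa (φ.symm v) * μb (φ u)) ≤ ∑ v, μa u * μb v :=
          sum_le_sum fun v _ => min_le_left _ _
      _ = μa u := by rw [← Finset.mul_sum, hμb1, mul_one]
  · calc ∑ v, min (μa u * μb v) (μa (φ.symm v) * μb (φ u)) ≤ ∑ v, μa (φ.symm v) * μb (φ u) :=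
          sum_le_sum fun v _ => min_le_right _ _
      _ = μb (φ u) := by
          rw [← Finset.sum_mul, Equiv.sum_comp φ.symm (fun w => μa w), hμa1, one_mul]

/-- **`Σ_u min{μ_a(u), μ_b(φu)} = 1 − ½Σ_u |μ_a(u) − μ_b(φu)|`** (`Σμ_a = Σμ_b = 1`). [ours] -/
theorem sum_min_eq_one_sub_tv {μa μb : S → ℝ} (hμa1 : ∑ u, μa u = 1) (hμb1 : ∑ u, μb u = 1)
    (φ : Equiv.Perm S) :
    ∑ u, min (μa u) (μb (φ u)) = 1 - (1 / 2) * ∑ u, |μa u - μb (φ u)| := by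
  have hmin : ∀ a b : ℝ, min a b = (a + b - |a - b|) / 2 := fun a b => by
    have h1 := min_add_max a b
    have h2 := max_sub_min_eq_abs' a b
    linarith
  simp_rw [hmin]
  have hb : ∑ u, μb (φ u) = 1 := by rw [Equiv.sum_comp φ (fun w => μb w), hμb1]
  rw [← Finset.sum_div, Finset.sum_sub_distrib, Finset.sum_add_distrib, hμa1, hb]
  ring

/-- **THE TRANSPORT DEFECT IS A HARD CEILING: `Acc(φ) ≤ 1 − ½Σ_u |μ_a(u) − μ_b(φu)|`** — one minus the total variation
distance between `μ_a` and the pull-back `μ_b∘φ` (`μ_a, μ_b` probability vectors). [ours] -/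
theorem flowPair_acceptance_le_one_sub_tv {μa μb : S → ℝ} (hμa1 : ∑ u, μa u = 1) (hμb1 : ∑ u, μb u = 1)
    (φ : Equiv.Perm S) :
    ∑ u, ∑ v, min (μa u * μb v) (μa (φ.symm v) * μb (φ u)) ≤ 1 - (1 / 2) * ∑ u, |μa u - μb (φ u)| := by
  rw [← sum_min_eq_one_sub_tv hμa1 hμb1 φ]
  exact flowPair_acceptance_le_marginal hμa1 hμb1 φ

/-- **THE BARE SWAP (`φ = 1`): `Acc ≤ 1 − ½Σ_u |μ_a(u) − μ_b(u)|`** — two well-separated levels are rarely exchanged,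
whatever else the sampler does. [ours] -/
theorem barePair_acceptance_le_one_sub_tv {μa μb : S → ℝ} (hμa1 : ∑ u, μa u = 1) (hμb1 : ∑ u, μb u = 1) :
    ∑ u, ∑ v, min (μa u * μb v) (μa v * μb u) ≤ 1 - (1 / 2) * ∑ u, |μa u - μb u| := by
  simpa using flowPair_acceptance_le_one_sub_tv hμa1 hμb1 (Equiv.refl S)

end Summit.Ventures.LatticeQCDFlow.Scaling

end
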